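import Summits.BirchSwinnertonDyer.BirchSwinnertonDyer.Theorems.KatoDescentPotSupersingularWildFineSelmerCentralLayerL11Records01
import Summits.BirchSwinnertonDyer.BirchSwinnertonDyer.Theorems.KatoDescentPotSupersingularWildUpperUnitTwistRecordsClassO619
import Summits.BirchSwinnertonDyer.BirchSwinnertonDyer.Theorems.KatoDescentPotSupersingularWildUpperUnitTwistRecordsClassO620
import Summits.BirchSwinnertonDyer.BirchSwinnertonDyer.Theorems.KatoDescentPotSupersingularWildUpperUnitTwistRecordsFlat01
import Summits.BirchSwinnertonDyer.BirchSwinnertonDyer.Theorems.KatoDescentPotSupersingularWildUpperUnitTwistRecordsSharp40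
import Summits.BirchSwinnertonDyer.BirchSwinnertonDyer.Theorems.KatoDescentPotSupersingularWildUpperUnitTwistRecordsSharpP05
import Literature.NumberTheory.EllipticCurves.FineSelmerTorsionPointFieldMuRoad
import Literature.NumberTheory.IwasawaTheory.ClassGroupPRankCoinvariantCriterion
import HarnessLib

/-!
# Route `KatoDescentPotSupersingular` (rung K9, sub-rung B5 = O6 wild `p = 3`, cell `bsd-potss`): per-row records on the FACT-FREE door L12
# (ONE-PAIR-OF-LAYERS COINVARIANT CRITERION at the torsion-point field `ℚ(P)`, layers `(1, 2)`): statement (A) of Coates–Sujatha at `(E, 3)` with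
# NO named fact, and U₀ modulo `hKatoA hGZK hmod`, for the K9 U₀-ns rows 42336r1 (the LAST row of the K9 U₀-ns table without a fact-free record before
# this file), 42336cz1, 447174gp1 (seat `bsd-potss-k9-c4` g26; `--supports stmt-BirchSwinnertonDyer-19197 --as helper`)

HONEST FRAMING. THEOREMS ONLY (no definition, no named fact, no `sorry`); PER ROW — NOT a class theorem; nothing is booked; items 19189 / 19197 / 19942 /
19386 stay OPEN at class level; Conjecture A and BSD are proved for NO class of curves.  Each theorem is CONDITIONAL on ONE displayed numerical hypothesis
about ONE degree-72 number field with its Galois action over its degree-24 subfield — computed by GENUS THEORY inside the degree-24 field (GRH class group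
and units there), NOT from the class group of the degree-72 field and NOT certified in the kernel.

ROAD (doors L8 (conjA-anchor g19) ∘ L12 (this seat), all KERNEL theorems; `p = 3`, `n₀ = n = 0`, `i = 1`, pair of layers `(1, 2)`): `E[3]` irreducible (kernel
`irr_g…_3`) and `Δ(E)` a CUBE (kernel) ⟹ `ρ̄_{E,3}` not onto ⟹ `3 ∤ #Gal(ℚ(E[3])/ℚ)` ⟹ tameness for door L8 and Fukuda index `0` for the cyclotomic `ℤ₃`-extension
of `ℚ(P) = ℚ̄^{Stab(P)} ⊆ ℚ(E[3])` — all in the KERNEL; plus ONE DISPLAYED hypothesis `hco`: **for every non-zero `P ∈ E[3]` and every cyclotomic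
`ℤ₃`-extension `κ_P` of `ℚ(P)`, the subgroup `Cl³·⟨σx·x⁻¹ : σ ∈ Gal(ℚ(P)₂/ℚ(P)), σ|_{ℚ(P)₁} = id⟩` of `Cl(ℚ(P)₂)` has index `≤ 3²`** — i.e. the
`Gal(ℚ(P)₂/ℚ(P)₁)`-COINVARIANTS of `Cl(ℚ(P)₂)/3` have `3`-rank `≤ 2` — ⟹ (door L12, `IwasawaTheory.classicalMuVanishes_of_coinvariant_index_le_succ_succ`: the
coinvariants are `X̄/T³X̄` whatever `Y₀` is, and a free `𝔽₃⟦T⟧`-summand of `X/3X` would contribute `3` to their rank) the `3`-ranks along the tower are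
bounded by `2` and `μ₃(ℚ(P)_cyc) = 0` ⟹ (door L8, `CoatesSujatha2005.conjA_of_classicalMuVanishes_stabilizerField`) statement (A) at `(E, 3)` for every
cyclotomic `ℤ₃`-extension of `ℚ` (`conjA_g…_3_L12`); and U₀ `MissingUpperBoundAt E 3` modulo the named facts `hKatoA hGZK hmod` + Cremona's `r_an = 0`
(`missingUpperBoundAt_g…_3_L12`, via k8t-c4's `WildFineSelmerSupersingularCMAnchor.missingUpperBoundAt_wild_of_conjA`).  NO `μ`-hypothesis, NO Ferrero–Washington,
NO Fukuda / Iwasawa-growth / Coates–Sujatha fact, NO class group of the degree-72 layer: these are exactly the rows where doors L5/L6/L10/L11/UG and Fukuda's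
two-layer tests are ALL silent at layers `≤ 1` (`Cl(ℚ(P)₁)[3] ≅ (ℤ/3)²` with ONE Jordan block of `Gal(ℚ(P)₁/ℚ(P))`, unit norm index short by one) — k9-c4
g23/g25, conjA-anchor g20/g21 §4: «only a degree-72 layer 2 can decide».  The coinvariant rank IS a layer-2 datum, but genus theory reads it in layer 1:
`rank₃ (A(ℚ(P)₂))_G = (s − 1 − r_E) + dim ker(i : A(ℚ(P)₁)[3] → A(ℚ(P)₂)_G)` (`0 → K → A(ℚ(P)₂)_G → A(ℚ(P)₁) → 0`, `#K = 3^{s−1−r_E}` elementary by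
Chevalley–Hasse, connecting map `= i`; `i(g) = 0 ⟺` the local cubic norm symbols of a generator of `𝔞³`, `g = [𝔞]`, lie in those of the units).
NUMERICS (k9-c4 g23, kit j316734 `capit23.gp`, PARI/GP 2.17, `bnfinit` flag 1, GRH for `Cl(ℚ(P)₁)` and `E_{ℚ(P)₁}`; RESULT file
`run/shared/lean/pub/bsd-potss/k9-c4/g23/kit/capit23/RESULT-capit23-j316734.txt`; regression = conjA-anchor g20 kit j329384 on the same octics): octic
`K8 = x^8 - 4x^7 + 8x^6 + 4x^5 - 72x^4 + 240x^3 - 432x^2 + 360x - 108` (= `ℚ(P)` of 42336r1 / 42336cz1 per the cell's census, `ψ₃/3` irreducible, k9-c4 g23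
j315922): `ℚ(P)₁ = K8·ℚ(ζ₉)⁺` degree 24, `h = 18`, `Cl = [6,3]`, `s = 5` primes above `3` all totally ramified in `ℚ(P)₂/ℚ(P)₁`, unit symbol rank `r_E = 3`,
`dim ker i = 1` ⟹ **coinvariant `3`-rank `(5−1−3) + 1 = 2`** (`#(A(ℚ(P)₂))_G = 27`, `≅ [9,3]`); octic `K8 = x^8 - 2x^7 + x^6 - 68x^5 + 196x^4 - 128x^3 + 883x^2
- 2714x + 1639` (= `ℚ(P)` of 447174gp1): `ℚ(P)₁` degree 24, `h = 216`, `Cl = [36,6]`, `s = 1` (`e = 24`), `r_E = 0`, `dim ker i = 2` ⟹ **coinvariant `3`-rank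
`0 + 2 = 2`** (one prime: the coinvariants of `A(ℚ(P)₂)/3` are `A(ℚ(P)₁)/3`).  The identification of the Lean field `fixedField (Stab P)` with `ℚ[x]/(K8)` is the
census memos' (all `ℚ(P)`, `P ≠ 0`, are conjugate: the image `C_ns⁺(3)` is transitive on `E[3] ∖ 0`), not a kernel statement.
KERNEL lemmas `isElliptic_g…`, `isGloballyMinimal_g…`, `irr_g…_3`, `classO6_g…_3`, `Δ_cube_g42336cz1` are IMPORTED (k9-c4 g16–g25 files, namespaces
`…Theorems.WildUpperUnitTwistRecords`, `…Theorems.WildFineSelmerLayerOneL5Records`); `Δ_cube_g42336r1`, `Δ_cube_g447174gp1` are proved here (`norm_num`).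

References: [CoatesSujatha2005] Thm. 3.4, Lemma 3.8; [Washington1997] §13.3 Lemma 13.18, Prop. 13.22–13.23; [Fukuda1994] Thm. 1 (proof, p. 264); [Lang1990]
Ch. 13 §4; [NeukirchANT1999] Ch. IV §6, Ch. VI §7 Thm. (7.1); [Serre1972] §2.4 Prop. 15, §5.3; [Kato2004Asterisque] Thm. 14.5 (3), Prop. 14.16 (2);
[Cremona2006] Table 1.
-/

set_option autoImplicit false
set_option linter.dupNamespace false

noncomputable section

open scoped Classical NumberField
open WeierstrassCurve NumberField Field IsDedekindDomain IntermediateField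
  Literature.NumberTheory.EllipticCurves Literature.NumberTheory.EllipticCurves.Rank1Residual
  Literature.NumberTheory.EllipticCurves.Rank1Residual.Typed
  Literature.NumberTheory.GaloisRepresentations Literature.NumberTheory.NumberFields
  Literature.NumberTheory.SerreUniformity Literature.NumberTheory.IwasawaTheory
  Summit.BirchSwinnertonDyer.Rank1Residual Summit.BirchSwinnertonDyer.Rank1Residual.Additive
  Summit.BirchSwinnertonDyer.BirchSwinnertonDyer.Theorems
  Summit.BirchSwinnertonDyer.BirchSwinnertonDyer.Theorems.AdditiveBranchIMCGordTwoRankOne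
  Summit.BirchSwinnertonDyer.BirchSwinnertonDyer.Theorems.WildUpperUnitTwistRecords

namespace Summit.BirchSwinnertonDyer.BirchSwinnertonDyer.Theorems.WildFineSelmerCoinvariantL12Records

/-! ## §0 The road (doors L8 ∘ L12 with Fukuda's index and tameness from `Δ` a cube) -/

set_option synthInstance.maxHeartbeats 400000 in
set_option maxHeartbeats 4000000 in
/-- **(A) at `(W, 3)` from the coinvariants of ONE degree-72 class group under its degree-24 subfield** (fact-free road of this file): `W/ℚ` elliptic,
`W[3]` irreducible, `Δ(W)` a cube (so `ρ̄_{W,3}` is not onto and `3 ∤ #Gal(ℚ(W[3])/ℚ)`: Fukuda index `0` at `ℚ(P) ⊆ ℚ(W[3])` and tameness, all kernel),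
`P ∈ W[3] ∖ 0`; DISPLAYED: for every cyclotomic `ℤ₃`-extension `κ_P` of `ℚ(P) = ℚ̄^{Stab(P)}`, the subgroup `Cl³·⟨σx·x⁻¹ : σ ∈ Gal(ℚ(P)₂/ℚ(P)), σ|_{ℚ(P)₁} = id⟩`
of `Cl(ℚ(P)₂)` has index `≤ 9`.  Then statement (A) holds for `W` at `3` over every cyclotomic `ℤ₃`-extension of `ℚ` (doors L12
`classicalMuVanishes_of_coinvariant_index_le_succ_succ` and L8 `CoatesSujatha2005.conjA_of_classicalMuVanishes_stabilizerField`).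
[cite: CoatesSujatha2005, §3 Thm. 3.4 and Lemma 3.8] [cite: Washington1997, §13.3 Lemma 13.18 and Prop. 13.22] [cite: Lang1990, Ch. 13 §4]
[cite: Serre1972, §2.4 Prop. 15, §5.3] [cite: NeukirchANT1999, Ch. IV §6 and Ch. VI §7 Thm. (7.1)] -/
theorem conjA_three_of_Δ_eq_cube_of_coinvariant_index_le (W : WeierstrassCurve ℚ) [W.IsElliptic]
    (hirr : W.HasIrreducibleModPGaloisRep 3) {d : ℚ} (hΔ : W.Δ = d ^ 3)
    (P : ↥(W.geomTorsion ((3 : ℕ) : ℤ))) (hP0 : P ≠ 0)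
    (hco : ∀ κP : ZpExtension ↥(fixedField (MulAction.stabilizer (absoluteGaloisGroup ℚ) P) :
        IntermediateField ℚ (AlgebraicClosure ℚ)) 3, κP.IsCyclotomic →
      ((powMonoidHom 3 : ClassGroup (𝓞 ↥(κP.layer (0 + (1 + 1)))) →* ClassGroup (𝓞 ↥(κP.layer (0 + (1 + 1))))).range ⊔
        Subgroup.closure {x | ∃ (σ : ↥(κP.layer (0 + (1 + 1))) ≃ₐ[↥(fixedField (MulAction.stabilizer (absoluteGaloisGroup ℚ) P) :
              IntermediateField ℚ (AlgebraicClosure ℚ))] ↥(κP.layer (0 + (1 + 1))))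
          (_ : ∀ y : ↥(κP.layer (0 + (1 + 1))), ((y : ↥(κP.layer (0 + (1 + 1)))) :
              AlgebraicClosure ↥(fixedField (MulAction.stabilizer (absoluteGaloisGroup ℚ) P) : IntermediateField ℚ (AlgebraicClosure ℚ))) ∈
              κP.layer (0 + 1) → σ y = y)
          (x' : ClassGroup (𝓞 ↥(κP.layer (0 + (1 + 1))))), x = ClassGroup.mulEquiv (AmbiguousClass.intAut σ) x' * x'⁻¹}).index ≤ 3 ^ 2)
    (κ : ZpExtension ℚ 3) (hκ : κ.IsCyclotomic) :
    ∃ (γ : absoluteGaloisGroup ℚ) (Df : W.FineSelmerDualData κ γ),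
      Module.Finite ℤ_[3] (RestrictScalars ℤ_[3] (IwasawaAlgebra 3) Df.X) := by
  haveI : Fact (Nat.Prime 3) := ⟨Nat.prime_three⟩
  have hns : ¬ W.HasSurjectiveModNGaloisRep 3 := ModThreeImage.not_hasSurjectiveModNGaloisRep_three_of_Δ_eq_cube W hΔ
  have hG : ¬ 3 ∣ Nat.card ((W.divisionField 3) ≃ₐ[ℚ] (W.divisionField 3)) :=
    SmallImageDickson.not_dvd_card_aut_divisionField W 3 hirr hns
  have hle : fixedField (MulAction.stabilizer (absoluteGaloisGroup ℚ) P) ≤ W.divisionField 3 :=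
    CoatesSujatha2005.fixedField_stabilizer_le_divisionField W P
  haveI : FiniteDimensional ℚ ↥(W.divisionField 3) := W.finiteDimensional_divisionField 3
  haveI : IsGalois ℚ ↥(W.divisionField 3) := W.isGalois_divisionField 3
  haveI : FiniteDimensional ℚ ↥(fixedField (MulAction.stabilizer (absoluteGaloisGroup ℚ) P)) :=
    FiniteDimensional.of_injective (IntermediateField.inclusion hle).toLinearMap (IntermediateField.inclusion_injective hle)
  haveI : NumberField ↥(fixedField (MulAction.stabilizer (absoluteGaloisGroup ℚ) P)) := NumberField.mk
  exact CoatesSujatha2005.conjA_of_classicalMuVanishes_stabilizerField W (by decide) hirr hG P hP0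
    (fun κP hκP => (classicalMuVanishes_of_coinvariant_index_le_succ_succ κP
      (CartanMuRoadFukudaDoorsTprime.totallyRamifiedFrom_zero_of_isCyclotomic_of_algHom_normal_of_not_dvd_card
        ↥(fixedField (MulAction.stabilizer (absoluteGaloisGroup ℚ) P)) (W.divisionField 3) 3 hG (IntermediateField.inclusion hle) κP hκP)
      (c := 2) (by norm_num) (hco κP hκP)).2) κ hκ

set_option synthInstance.maxHeartbeats 400000 in
set_option maxHeartbeats 4000000 in
/-- **U₀ `ord₃ #Ш(W) ≤ ord₃ #Ш(W)_an` from the same datum** (modulo the named facts `hKatoA` (Kato's fine-Selmer reading of 14.5 (3)), `hGZK`, `hmod`, and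
Cremona's `r_an = 0`): `W/ℚ` minimal, `ClassO6 W 3`, `W[3]` irreducible, `Δ(W)` a cube, `P ≠ 0`, and the displayed coinvariant index bound at `ℚ(P)` —
then `MissingUpperBoundAt W 3` (k8t-c4's `WildFineSelmerSupersingularCMAnchor.missingUpperBoundAt_wild_of_conjA` over the (A)-door above). CONDITIONAL; nothing booked;
BSD proved for no curve. [cite: Kato2004Asterisque, Thm. 14.5 (3) (p. 236) and Prop. 14.16 (2)] [cite: CoatesSujatha2005, §3 Thm. 3.4]
[cite: Washington1997, §13.3 Prop. 13.22–13.23] [cite: Serre1972, §2.4 Prop. 15, §5.3] -/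
theorem missingUpperBoundAt_three_of_Δ_eq_cube_of_coinvariant_index_le
    (hKatoA : Kato2004.rankZero_padicValNat_sha_add_padicValNat_tamagawa_le_of_additive_potGood_of_irreducible_of_fineSelmerDual_fg)
    (hGZK : rank_eq_analyticRank_of_analyticRank_le_one) (hmod : hasEntireLFunction_rat)
    (W : WeierstrassCurve ℚ) [W.IsElliptic] [W.IsGloballyMinimal] (hr : W.analyticRank = 0) (hO : ClassO6 W 3)
    (hirr : W.HasIrreducibleModPGaloisRep 3) {d : ℚ} (hΔ : W.Δ = d ^ 3)
    (P : ↥(W.geomTorsion ((3 : ℕ) : ℤ))) (hP0 : P ≠ 0)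
    (hco : ∀ κP : ZpExtension ↥(fixedField (MulAction.stabilizer (absoluteGaloisGroup ℚ) P) :
        IntermediateField ℚ (AlgebraicClosure ℚ)) 3, κP.IsCyclotomic →
      ((powMonoidHom 3 : ClassGroup (𝓞 ↥(κP.layer (0 + (1 + 1)))) →* ClassGroup (𝓞 ↥(κP.layer (0 + (1 + 1))))).range ⊔
        Subgroup.closure {x | ∃ (σ : ↥(κP.layer (0 + (1 + 1))) ≃ₐ[↥(fixedField (MulAction.stabilizer (absoluteGaloisGroup ℚ) P) :
              IntermediateField ℚ (AlgebraicClosure ℚ))] ↥(κP.layer (0 + (1 + 1))))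
          (_ : ∀ y : ↥(κP.layer (0 + (1 + 1))), ((y : ↥(κP.layer (0 + (1 + 1)))) :
              AlgebraicClosure ↥(fixedField (MulAction.stabilizer (absoluteGaloisGroup ℚ) P) : IntermediateField ℚ (AlgebraicClosure ℚ))) ∈
              κP.layer (0 + 1) → σ y = y)
          (x' : ClassGroup (𝓞 ↥(κP.layer (0 + (1 + 1))))), x = ClassGroup.mulEquiv (AmbiguousClass.intAut σ) x' * x'⁻¹}).index ≤ 3 ^ 2) :
    MissingUpperBoundAt W 3 := by
  haveI : Fact (Nat.Prime 3) := ⟨Nat.prime_three⟩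
  exact WildFineSelmerSupersingularCMAnchor.missingUpperBoundAt_wild_of_conjA hKatoA hGZK hmod W hr hO hirr
    (fun κ hκ => conjA_three_of_Δ_eq_cube_of_coinvariant_index_le W hirr hΔ P hP0 hco κ hκ)

/-! ## §1 The rows -/

/-! ### `42336r1` @ `p = 3` — `N = 42336 = 2^5·3^3·7^2`; Cremona: `r_an = 0`; O6 wild at `3`; image: normaliser of a NON-split Cartan (census), `Δ = (-8232)³`;
`ℚ(P)` octic `K8 = x^8 - 4x^7 + 8x^6 + 4x^5 - 72x^4 + 240x^3 - 432x^2 + 360x - 108` (`h = 2`, five primes above `3`, unit symbol rank `3 < 4`: Iwasawa-1956 /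
UG / Fukuda (0,1) / L10 / L11 doors ALL shut; L5 void: `E(ℚ₃)[3] ≠ 0` and `ρ̄` occurs in `Cl(ℚ(E[3])₁)/3`); LAYERS (1,2) (kit j316734, GRH): `Cl(ℚ(P)₁) = [6,3]`,
`σ` one Jordan block on `Cl/3`; genus number of `ℚ(P)₂/ℚ(P)₁`: `27`, coinvariant `3`-rank `2`.  THE LAST K9 U₀-ns row without a fact-free record before this file. -/

/-- `Δ(42336r1) = (-8232)³` — a CUBE (kernel, `norm_num`). [cite: Serre1972, §5.3] [cite: Cremona2006, Table 1 (Cremona label 42336r1)] -/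
theorem Δ_cube_g42336r1 : (⟨0, 0, 0, 1029, (-33614)⟩ : WeierstrassCurve ℚ).Δ = (((-8232) : ℚ)) ^ 3 := by
  norm_num [WeierstrassCurve.Δ, WeierstrassCurve.b₂, WeierstrassCurve.b₄, WeierstrassCurve.b₆, WeierstrassCurve.b₈]

/-- **(A) AT `(42336r1, 3)` — NO NAMED FACT** (door L12 ∘ L8): KERNEL `irr_g42336r1_3`, `Δ_cube_g42336r1`; DISPLAYED `hco` («the `Gal(ℚ(P)₂/ℚ(P)₁)`-coinvariants
of `Cl(ℚ(P)₂)/3` have `3`-rank `≤ 2`», every `P ≠ 0`, every cyclotomic `κ_P`; kit j316734: genus theory in `ℚ(P)₁`, `(s−1−r_E) + dim ker i = 1 + 1 = 2`, GRH).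
Per row; nothing booked; (A)/BSD proved for no class. [cite: CoatesSujatha2005, §3 Thm. 3.4 and Lemma 3.8] [cite: Washington1997, §13.3 Lemma 13.18 and Prop. 13.22]
[cite: Lang1990, Ch. 13 §4] [cite: Cremona2006, Table 1 (Cremona label 42336r1)] -/
theorem conjA_g42336r1_3_L12
    {W : WeierstrassCurve ℚ} [W.IsElliptic] (hWeq : W = (⟨0, 0, 0, 1029, (-33614)⟩ : WeierstrassCurve ℚ))
    (P : ↥(W.geomTorsion ((3 : ℕ) : ℤ))) (hP0 : P ≠ 0)
    (hco : ∀ κP : ZpExtension ↥(fixedField (MulAction.stabilizer (absoluteGaloisGroup ℚ) P) :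
        IntermediateField ℚ (AlgebraicClosure ℚ)) 3, κP.IsCyclotomic →
      ((powMonoidHom 3 : ClassGroup (𝓞 ↥(κP.layer (0 + (1 + 1)))) →* ClassGroup (𝓞 ↥(κP.layer (0 + (1 + 1))))).range ⊔
        Subgroup.closure {x | ∃ (σ : ↥(κP.layer (0 + (1 + 1))) ≃ₐ[↥(fixedField (MulAction.stabilizer (absoluteGaloisGroup ℚ) P) :
              IntermediateField ℚ (AlgebraicClosure ℚ))] ↥(κP.layer (0 + (1 + 1))))
          (_ : ∀ y : ↥(κP.layer (0 + (1 + 1))), ((y : ↥(κP.layer (0 + (1 + 1)))) :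
              AlgebraicClosure ↥(fixedField (MulAction.stabilizer (absoluteGaloisGroup ℚ) P) : IntermediateField ℚ (AlgebraicClosure ℚ))) ∈
              κP.layer (0 + 1) → σ y = y)
          (x' : ClassGroup (𝓞 ↥(κP.layer (0 + (1 + 1))))), x = ClassGroup.mulEquiv (AmbiguousClass.intAut σ) x' * x'⁻¹}).index ≤ 3 ^ 2)
    (κ : ZpExtension ℚ 3) (hκ : κ.IsCyclotomic) :
    ∃ (γ : absoluteGaloisGroup ℚ) (Df : W.FineSelmerDualData κ γ),
      Module.Finite ℤ_[3] (RestrictScalars ℤ_[3] (IwasawaAlgebra 3) Df.X) := by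
  subst hWeq
  exact conjA_three_of_Δ_eq_cube_of_coinvariant_index_le _ irr_g42336r1_3 Δ_cube_g42336r1 P hP0 hco κ hκ

/-- **RECORD — U₀ `ord₃ #Ш(E) ≤ ord₃ #Ш(E)_an` for `E = 42336r1` at `p = 3` on the fact-free door L12** (U₀-ns row of K9 items 19189 / 19197): KERNEL `classO6_g42336r1_3`,
`irr_g42336r1_3`, `Δ_cube_g42336r1`; DISPLAYED named facts `hKatoA hGZK hmod` ONLY, Cremona's `r_an = 0` (`hr`), and `hco` (kit j316734, GRH). Per row; nothing booked;
BSD is not proved by this. [cite: Kato2004Asterisque, Thm. 14.5 (3) (p. 236) and Prop. 14.16 (2)] [cite: CoatesSujatha2005, §3 Thm. 3.4]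
[cite: Cremona2006, Table 1 (Cremona label 42336r1)] -/
theorem missingUpperBoundAt_g42336r1_3_L12
    (hKatoA : Kato2004.rankZero_padicValNat_sha_add_padicValNat_tamagawa_le_of_additive_potGood_of_irreducible_of_fineSelmerDual_fg)
    (hGZK : rank_eq_analyticRank_of_analyticRank_le_one) (hmod : hasEntireLFunction_rat)
    {W : WeierstrassCurve ℚ} [W.IsElliptic] [W.IsGloballyMinimal] (hWeq : W = (⟨0, 0, 0, 1029, (-33614)⟩ : WeierstrassCurve ℚ))
    (hr : W.analyticRank = 0) (P : ↥(W.geomTorsion ((3 : ℕ) : ℤ))) (hP0 : P ≠ 0)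
    (hco : ∀ κP : ZpExtension ↥(fixedField (MulAction.stabilizer (absoluteGaloisGroup ℚ) P) :
        IntermediateField ℚ (AlgebraicClosure ℚ)) 3, κP.IsCyclotomic →
      ((powMonoidHom 3 : ClassGroup (𝓞 ↥(κP.layer (0 + (1 + 1)))) →* ClassGroup (𝓞 ↥(κP.layer (0 + (1 + 1))))).range ⊔
        Subgroup.closure {x | ∃ (σ : ↥(κP.layer (0 + (1 + 1))) ≃ₐ[↥(fixedField (MulAction.stabilizer (absoluteGaloisGroup ℚ) P) :
              IntermediateField ℚ (AlgebraicClosure ℚ))] ↥(κP.layer (0 + (1 + 1))))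
          (_ : ∀ y : ↥(κP.layer (0 + (1 + 1))), ((y : ↥(κP.layer (0 + (1 + 1)))) :
              AlgebraicClosure ↥(fixedField (MulAction.stabilizer (absoluteGaloisGroup ℚ) P) : IntermediateField ℚ (AlgebraicClosure ℚ))) ∈
              κP.layer (0 + 1) → σ y = y)
          (x' : ClassGroup (𝓞 ↥(κP.layer (0 + (1 + 1))))), x = ClassGroup.mulEquiv (AmbiguousClass.intAut σ) x' * x'⁻¹}).index ≤ 3 ^ 2) :
    MissingUpperBoundAt W 3 := by
  subst hWeq
  exact missingUpperBoundAt_three_of_Δ_eq_cube_of_coinvariant_index_le hKatoA hGZK hmod _ hr classO6_g42336r1_3 irr_g42336r1_3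
    Δ_cube_g42336r1 P hP0 hco

/-! ### `42336cz1` @ `p = 3` — `N = 42336 = 2^5·3^3·7^2`; Cremona: `r_an = 0`; O6 wild at `3`; `Δ = (-74088)³` (kernel `WildFineSelmerLayerOneL5Records.Δ_cube_g42336cz1`);
`ℚ(P)` = the octic of 42336r1 per the cell's census (k9-c4 g23 j315922: same `K8`); LAYERS (1,2) (kit j316734, GRH): coinvariant `3`-rank `2`.  (This row already holds a
fact-free L5 record, k9-c4 g25 `conjA_g42336cz1_3_L5`; this is a second, independent fact-free road.) -/

/-- **(A) AT `(42336cz1, 3)` — NO NAMED FACT** (door L12 ∘ L8): KERNEL `irr_g42336cz1_3`, `Δ_cube_g42336cz1`; DISPLAYED `hco` (kit j316734: coinvariant `3`-rank `2`, GRH).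
Per row; nothing booked; (A)/BSD proved for no class. [cite: CoatesSujatha2005, §3 Thm. 3.4 and Lemma 3.8] [cite: Washington1997, §13.3 Lemma 13.18 and Prop. 13.22]
[cite: Lang1990, Ch. 13 §4] [cite: Cremona2006, Table 1 (Cremona label 42336cz1)] -/
theorem conjA_g42336cz1_3_L12
    {W : WeierstrassCurve ℚ} [W.IsElliptic] (hWeq : W = (⟨0, 0, 0, 9261, 907578⟩ : WeierstrassCurve ℚ))
    (P : ↥(W.geomTorsion ((3 : ℕ) : ℤ))) (hP0 : P ≠ 0)
    (hco : ∀ κP : ZpExtension ↥(fixedField (MulAction.stabilizer (absoluteGaloisGroup ℚ) P) :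
        IntermediateField ℚ (AlgebraicClosure ℚ)) 3, κP.IsCyclotomic →
      ((powMonoidHom 3 : ClassGroup (𝓞 ↥(κP.layer (0 + (1 + 1)))) →* ClassGroup (𝓞 ↥(κP.layer (0 + (1 + 1))))).range ⊔
        Subgroup.closure {x | ∃ (σ : ↥(κP.layer (0 + (1 + 1))) ≃ₐ[↥(fixedField (MulAction.stabilizer (absoluteGaloisGroup ℚ) P) :
              IntermediateField ℚ (AlgebraicClosure ℚ))] ↥(κP.layer (0 + (1 + 1))))
          (_ : ∀ y : ↥(κP.layer (0 + (1 + 1))), ((y : ↥(κP.layer (0 + (1 + 1)))) :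
              AlgebraicClosure ↥(fixedField (MulAction.stabilizer (absoluteGaloisGroup ℚ) P) : IntermediateField ℚ (AlgebraicClosure ℚ))) ∈
              κP.layer (0 + 1) → σ y = y)
          (x' : ClassGroup (𝓞 ↥(κP.layer (0 + (1 + 1))))), x = ClassGroup.mulEquiv (AmbiguousClass.intAut σ) x' * x'⁻¹}).index ≤ 3 ^ 2)
    (κ : ZpExtension ℚ 3) (hκ : κ.IsCyclotomic) :
    ∃ (γ : absoluteGaloisGroup ℚ) (Df : W.FineSelmerDualData κ γ),
      Module.Finite ℤ_[3] (RestrictScalars ℤ_[3] (IwasawaAlgebra 3) Df.X) := by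
  subst hWeq
  exact conjA_three_of_Δ_eq_cube_of_coinvariant_index_le _ irr_g42336cz1_3 WildFineSelmerLayerOneL5Records.Δ_cube_g42336cz1 P hP0 hco κ hκ

/-- **RECORD — U₀ for `E = 42336cz1` at `p = 3` on the fact-free door L12**: KERNEL `classO6_g42336cz1_3`, `irr_g42336cz1_3`, `Δ_cube_g42336cz1`; DISPLAYED `hKatoA hGZK hmod`,
`hr`, `hco` (kit j316734, GRH). Per row; nothing booked; BSD is not proved by this. [cite: Kato2004Asterisque, Thm. 14.5 (3) (p. 236) and Prop. 14.16 (2)]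
[cite: CoatesSujatha2005, §3 Thm. 3.4] [cite: Cremona2006, Table 1 (Cremona label 42336cz1)] -/
theorem missingUpperBoundAt_g42336cz1_3_L12
    (hKatoA : Kato2004.rankZero_padicValNat_sha_add_padicValNat_tamagawa_le_of_additive_potGood_of_irreducible_of_fineSelmerDual_fg)
    (hGZK : rank_eq_analyticRank_of_analyticRank_le_one) (hmod : hasEntireLFunction_rat)
    {W : WeierstrassCurve ℚ} [W.IsElliptic] [W.IsGloballyMinimal] (hWeq : W = (⟨0, 0, 0, 9261, 907578⟩ : WeierstrassCurve ℚ))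
    (hr : W.analyticRank = 0) (P : ↥(W.geomTorsion ((3 : ℕ) : ℤ))) (hP0 : P ≠ 0)
    (hco : ∀ κP : ZpExtension ↥(fixedField (MulAction.stabilizer (absoluteGaloisGroup ℚ) P) :
        IntermediateField ℚ (AlgebraicClosure ℚ)) 3, κP.IsCyclotomic →
      ((powMonoidHom 3 : ClassGroup (𝓞 ↥(κP.layer (0 + (1 + 1)))) →* ClassGroup (𝓞 ↥(κP.layer (0 + (1 + 1))))).range ⊔
        Subgroup.closure {x | ∃ (σ : ↥(κP.layer (0 + (1 + 1))) ≃ₐ[↥(fixedField (MulAction.stabilizer (absoluteGaloisGroup ℚ) P) :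
              IntermediateField ℚ (AlgebraicClosure ℚ))] ↥(κP.layer (0 + (1 + 1))))
          (_ : ∀ y : ↥(κP.layer (0 + (1 + 1))), ((y : ↥(κP.layer (0 + (1 + 1)))) :
              AlgebraicClosure ↥(fixedField (MulAction.stabilizer (absoluteGaloisGroup ℚ) P) : IntermediateField ℚ (AlgebraicClosure ℚ))) ∈
              κP.layer (0 + 1) → σ y = y)
          (x' : ClassGroup (𝓞 ↥(κP.layer (0 + (1 + 1))))), x = ClassGroup.mulEquiv (AmbiguousClass.intAut σ) x' * x'⁻¹}).index ≤ 3 ^ 2) :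
    MissingUpperBoundAt W 3 := by
  subst hWeq
  exact missingUpperBoundAt_three_of_Δ_eq_cube_of_coinvariant_index_le hKatoA hGZK hmod _ hr classO6_g42336cz1_3 irr_g42336cz1_3
    WildFineSelmerLayerOneL5Records.Δ_cube_g42336cz1 P hP0 hco

/-! ### `447174gp1` @ `p = 3` — `N = 447174 = 2·3^3·7^2·13^2`; Cremona: `r_an = 0`; O6 wild at `3`; image: normaliser of a NON-split Cartan (census), `Δ = (40692834)³`;
`ℚ(P)` octic `K8 = x^8 - 2x^7 + x^6 - 68x^5 + 196x^4 - 128x^3 + 883x^2 - 2714x + 1639` (ONE prime above `3`, `h = 24`: Iwasawa 1956 shut; `e 1 → 3`, `r 1 → 2` at layers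
`(0,1)`: Fukuda shut; `rank₃ Cl(ℚ(P)₁) = 2`: L10 shut; `σ` ≠ id on `Cl(ℚ(P)₁)/3`: L11 shut; L5/L6 void); LAYERS (1,2) (kit j316734, GRH): `Cl(ℚ(P)₁) = [36,6]`, one prime so
the coinvariants of `Cl(ℚ(P)₂)/3` ARE `Cl(ℚ(P)₁)/3`: coinvariant `3`-rank `2`. -/

/-- `Δ(447174gp1) = (40692834)³` — a CUBE (kernel, `norm_num`). [cite: Serre1972, §5.3] [cite: Cremona2006, Table 1 (Cremona label 447174gp1)] -/
theorem Δ_cube_g447174gp1 : (⟨1, (-1), 1, (-13988162), 15799310713⟩ : WeierstrassCurve ℚ).Δ = (((40692834) : ℚ)) ^ 3 := by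
  norm_num [WeierstrassCurve.Δ, WeierstrassCurve.b₂, WeierstrassCurve.b₄, WeierstrassCurve.b₆, WeierstrassCurve.b₈]

/-- **(A) AT `(447174gp1, 3)` — NO NAMED FACT** (door L12 ∘ L8): KERNEL `irr_g447174gp1_3`, `Δ_cube_g447174gp1`; DISPLAYED `hco` (kit j316734: one prime above `3`,
`rank₃ Cl(ℚ(P)₁) = 2` = coinvariant `3`-rank, GRH). Per row; nothing booked; (A)/BSD proved for no class. [cite: CoatesSujatha2005, §3 Thm. 3.4 and Lemma 3.8]
[cite: Washington1997, §13.3 Lemma 13.18 and Prop. 13.22] [cite: Lang1990, Ch. 13 §4] [cite: Cremona2006, Table 1 (Cremona label 447174gp1)] -/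
theorem conjA_g447174gp1_3_L12
    {W : WeierstrassCurve ℚ} [W.IsElliptic] (hWeq : W = (⟨1, (-1), 1, (-13988162), 15799310713⟩ : WeierstrassCurve ℚ))
    (P : ↥(W.geomTorsion ((3 : ℕ) : ℤ))) (hP0 : P ≠ 0)
    (hco : ∀ κP : ZpExtension ↥(fixedField (MulAction.stabilizer (absoluteGaloisGroup ℚ) P) :
        IntermediateField ℚ (AlgebraicClosure ℚ)) 3, κP.IsCyclotomic →
      ((powMonoidHom 3 : ClassGroup (𝓞 ↥(κP.layer (0 + (1 + 1)))) →* ClassGroup (𝓞 ↥(κP.layer (0 + (1 + 1))))).range ⊔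
        Subgroup.closure {x | ∃ (σ : ↥(κP.layer (0 + (1 + 1))) ≃ₐ[↥(fixedField (MulAction.stabilizer (absoluteGaloisGroup ℚ) P) :
              IntermediateField ℚ (AlgebraicClosure ℚ))] ↥(κP.layer (0 + (1 + 1))))
          (_ : ∀ y : ↥(κP.layer (0 + (1 + 1))), ((y : ↥(κP.layer (0 + (1 + 1)))) :
              AlgebraicClosure ↥(fixedField (MulAction.stabilizer (absoluteGaloisGroup ℚ) P) : IntermediateField ℚ (AlgebraicClosure ℚ))) ∈
              κP.layer (0 + 1) → σ y = y)
          (x' : ClassGroup (𝓞 ↥(κP.layer (0 + (1 + 1))))), x = ClassGroup.mulEquiv (AmbiguousClass.intAut σ) x' * x'⁻¹}).index ≤ 3 ^ 2)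
    (κ : ZpExtension ℚ 3) (hκ : κ.IsCyclotomic) :
    ∃ (γ : absoluteGaloisGroup ℚ) (Df : W.FineSelmerDualData κ γ),
      Module.Finite ℤ_[3] (RestrictScalars ℤ_[3] (IwasawaAlgebra 3) Df.X) := by
  subst hWeq
  exact conjA_three_of_Δ_eq_cube_of_coinvariant_index_le _ irr_g447174gp1_3 Δ_cube_g447174gp1 P hP0 hco κ hκ

/-- **RECORD — U₀ for `E = 447174gp1` at `p = 3` on the fact-free door L12**: KERNEL `classO6_g447174gp1_3`, `irr_g447174gp1_3`, `Δ_cube_g447174gp1`; DISPLAYED `hKatoA hGZK hmod`,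
`hr`, `hco` (kit j316734, GRH). Per row; nothing booked; BSD is not proved by this. [cite: Kato2004Asterisque, Thm. 14.5 (3) (p. 236) and Prop. 14.16 (2)]
[cite: CoatesSujatha2005, §3 Thm. 3.4] [cite: Cremona2006, Table 1 (Cremona label 447174gp1)] -/
theorem missingUpperBoundAt_g447174gp1_3_L12
    (hKatoA : Kato2004.rankZero_padicValNat_sha_add_padicValNat_tamagawa_le_of_additive_potGood_of_irreducible_of_fineSelmerDual_fg)
    (hGZK : rank_eq_analyticRank_of_analyticRank_le_one) (hmod : hasEntireLFunction_rat)
    {W : WeierstrassCurve ℚ} [W.IsElliptic] [W.IsGloballyMinimal] (hWeq : W = (⟨1, (-1), 1, (-13988162), 15799310713⟩ : WeierstrassCurve ℚ))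
    (hr : W.analyticRank = 0) (P : ↥(W.geomTorsion ((3 : ℕ) : ℤ))) (hP0 : P ≠ 0)
    (hco : ∀ κP : ZpExtension ↥(fixedField (MulAction.stabilizer (absoluteGaloisGroup ℚ) P) :
        IntermediateField ℚ (AlgebraicClosure ℚ)) 3, κP.IsCyclotomic →
      ((powMonoidHom 3 : ClassGroup (𝓞 ↥(κP.layer (0 + (1 + 1)))) →* ClassGroup (𝓞 ↥(κP.layer (0 + (1 + 1))))).range ⊔
        Subgroup.closure {x | ∃ (σ : ↥(κP.layer (0 + (1 + 1))) ≃ₐ[↥(fixedField (MulAction.stabilizer (absoluteGaloisGroup ℚ) P) :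
              IntermediateField ℚ (AlgebraicClosure ℚ))] ↥(κP.layer (0 + (1 + 1))))
          (_ : ∀ y : ↥(κP.layer (0 + (1 + 1))), ((y : ↥(κP.layer (0 + (1 + 1)))) :
              AlgebraicClosure ↥(fixedField (MulAction.stabilizer (absoluteGaloisGroup ℚ) P) : IntermediateField ℚ (AlgebraicClosure ℚ))) ∈
              κP.layer (0 + 1) → σ y = y)
          (x' : ClassGroup (𝓞 ↥(κP.layer (0 + (1 + 1))))), x = ClassGroup.mulEquiv (AmbiguousClass.intAut σ) x' * x'⁻¹}).index ≤ 3 ^ 2) :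
    MissingUpperBoundAt W 3 := by
  subst hWeq
  exact missingUpperBoundAt_three_of_Δ_eq_cube_of_coinvariant_index_le hKatoA hGZK hmod _ hr classO6_g447174gp1_3 irr_g447174gp1_3
    Δ_cube_g447174gp1 P hP0 hco

end Summit.BirchSwinnertonDyer.BirchSwinnertonDyer.Theorems.WildFineSelmerCoinvariantL12Records

end
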